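import Summits.CriticalPhenomena.SAWScalingLimit.Theorems.SAWTotalPositivityBoundaryHarnackGadgetDefs
import Summits.CriticalPhenomena.SAWScalingLimit.Theorems.SAWTotalPositivityBoundaryHarnackWalks
import Literature.Probability.LatticeModels.WeakBeurlingEstimate

/-!
# The corridor gadget for `BoundaryHarnack` (stmt-CriticalPhenomena-7120): lattice geometry

The sites (all in `ℤ²`, mesh `1`; parameters `N, M ≥ 2`):

* the **notched half-box** `Λ_N = ([-N, N] × [0, N]) \ {(0,1)}` (`halfBox N`), with the marked
  boundary sites `b' = (-1,0)`, `b = (0,0)`, `c = (1,0)` (so `b` has exactly the two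
  `Λ_N`-neighbours `b'`, `c`) and the gateway `g_R = (-N, 0)`;
* the **corridor** `cor N M 0 = t = (-1,-1)`, `cor N M 1 = (-1,-2)`, …, down to `(-1,-M)`, left
  along the row `-M` to `(-N-1,-M)`, up the column `-N-1` to `g_L = (-N-1, 0) = cor N M (m-1)`,
  and `cor N M m = g_R`, `m = 2M + N` (`corSet N M` = the sites of index `< m`);
* the **gadget** `V = Λ_N ∪ corridor` (`gadget N M`).

Definitions are in `…GadgetDefs`. Proved here: coordinates and membership bookkeeping, the privacy of the corridor (every lattice
neighbour in `V` of an internal corridor site is the previous or the next corridor site,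
`corridor_private`), the neighbourhoods of `t` and `b` in `V`, lattice connectivity of `Λ_N` and of
`V`, and the connection `t ⇝ c` inside `V \ {b', b}`. Everything proved. [folklore]
-/

noncomputable section

namespace Summit.CriticalPhenomena.SAWScalingLimit.Theorems.BoundaryHarnack.Negative

open Literature.Probability.LatticeModels Set Relation

/-! ### Coordinates of the corridor -/

/-- The coordinates of the corridor sites, by segment. [folklore] -/
theorem cor_spec (N M i : ℕ) :
    ((i : ℤ) + 1 ≤ M ∧ (cor N M i) 0 = -1 ∧ (cor N M i) 1 = -1 - (i : ℤ)) ∨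
    ((M : ℤ) ≤ i ∧ (i : ℤ) ≤ (M : ℤ) - 1 + N ∧ (cor N M i) 0 = (M : ℤ) - i - 2 ∧
      (cor N M i) 1 = -(M : ℤ)) ∨
    ((M : ℤ) + N ≤ i ∧ (i : ℤ) ≤ 2 * (M : ℤ) + N - 1 ∧ (cor N M i) 0 = -(N : ℤ) - 1 ∧
      (cor N M i) 1 = (i : ℤ) - 2 * M - N + 1) ∨
    (2 * (M : ℤ) + N ≤ i ∧ (cor N M i) 0 = -(N : ℤ) ∧ (cor N M i) 1 = 0) := by
  unfold cor
  split_ifs with h1 h2 h3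
  · left; exact ⟨h1, by simp, by simp⟩
  · right; left; exact ⟨by omega, h2, by simp, by simp⟩
  · right; right; left; exact ⟨by omega, h3, by simp, by simp⟩
  · right; right; right; exact ⟨by omega, by simp, by simp⟩

variable {N M : ℕ}

/-- Corridor sites have `x₁ ≤ -1`, or lie on the column `x₀ = -N-1`; in particular they are
outside the half-box. [folklore] -/
theorem cor_coord_bounds (hM : 2 ≤ M) {i : ℕ} (hi : i < 2 * M + N) :
    (-(N : ℤ) - 1 ≤ (cor N M i) 0 ∧ (cor N M i) 0 ≤ -1) ∧
      (-(M : ℤ) ≤ (cor N M i) 1 ∧ (cor N M i) 1 ≤ 0) ∧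
      ((cor N M i) 1 ≤ -1 ∨ (cor N M i) 0 = -(N : ℤ) - 1) := by
  have := cor_spec N M i
  omega

/-- The half-box and the corridor are disjoint. [folklore] -/
theorem not_mem_halfBox_of_mem_corSet (hM : 2 ≤ M) {x : Site 2} (hx : x ∈ corSet N M) :
    x ∉ halfBox N := by
  obtain ⟨i, hi, rfl⟩ := hx
  have := cor_coord_bounds (N := N) hM hi
  rw [mem_halfBox_iff]
  omega

/-- A site of the gadget outside the corridor lies in the half-box. [folklore] -/
theorem mem_halfBox_of_mem_gadget {x : Site 2} (hx : x ∈ gadget N M) (hx' : x ∉ corSet N M) :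
    x ∈ halfBox N := hx.resolve_right hx'

/-! ### The marked sites -/

/-- `t = (-1,-1) = cor N M 0`. [folklore] -/
theorem cor_zero (hM : 2 ≤ M) : cor N M 0 = ![-1, -1] := by
  unfold cor; rw [if_pos (by push_cast; omega)]; simp

/-- `cor N M 1 = (-1,-2)`. [folklore] -/
theorem cor_one (hM : 2 ≤ M) : cor N M 1 = ![-1, -2] := by
  unfold cor; rw [if_pos (by push_cast; omega)]; norm_num

/-- `g_R = (-N, 0) = cor N M (2M+N)`. [folklore] -/
theorem cor_m : cor N M (2 * M + N) = ![-(N : ℤ), 0] := by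
  unfold cor
  rw [if_neg (by push_cast; omega), if_neg (by push_cast; omega), if_neg (by push_cast; omega)]

/-- `t ∈ corridor`. [folklore] -/
theorem t_mem_corSet (hM : 2 ≤ M) : ![-1, -1] ∈ corSet N M :=
  ⟨0, by omega, (cor_zero hM).symm⟩

/-- `b' = (-1,0) ∈ Λ_N`. [folklore] -/
theorem b'_mem_halfBox (hN : 2 ≤ N) : ![-1, 0] ∈ halfBox N := by
  rw [mem_halfBox_iff]; simp only [Matrix.cons_val_zero, Matrix.cons_val_one]; omega

/-- `b = (0,0) ∈ Λ_N`. [folklore] -/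
theorem b_mem_halfBox : ![0, 0] ∈ halfBox N := by
  rw [mem_halfBox_iff]; simp only [Matrix.cons_val_zero, Matrix.cons_val_one]; omega

/-- `c = (1,0) ∈ Λ_N`. [folklore] -/
theorem c_mem_halfBox (hN : 2 ≤ N) : ![1, 0] ∈ halfBox N := by
  rw [mem_halfBox_iff]; simp only [Matrix.cons_val_zero, Matrix.cons_val_one]; omega

/-- `g_R = (-N,0) ∈ Λ_N`. [folklore] -/
theorem gR_mem_halfBox (hN : 2 ≤ N) : ![-(N : ℤ), 0] ∈ halfBox N := by
  rw [mem_halfBox_iff]; simp only [Matrix.cons_val_zero, Matrix.cons_val_one]; omega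

/-- `b' ∉ corridor`, indeed no corridor site of index `≥ 1`… precisely: `cor N M i ≠ b'` for all
`i`. [folklore] -/
theorem cor_ne_b' (hN : 2 ≤ N) (i : ℕ) : cor N M i ≠ ![-1, 0] := by
  intro h
  rw [vec2_eq_iff] at h
  have := cor_spec N M i
  omega

/-- `cor N M i ≠ b` for all `i`. [folklore] -/
theorem cor_ne_b (hN : 2 ≤ N) (i : ℕ) : cor N M i ≠ ![0, 0] := by
  intro h
  rw [vec2_eq_iff] at h
  have := cor_spec N M i
  omega

/-! ### Bounding box -/

/-- The gadget lies in the box `[-N-1, N] × [-M, N]`. [folklore] -/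
theorem gadget_subset_boxSites (hM : 2 ≤ M) :
    gadget N M ⊆ boxSites ![-(N : ℤ) - 1, -(M : ℤ)] ![(N : ℤ), N] := by
  intro x hx
  rw [mem_boxSites_iff, Fin.forall_fin_two]
  simp only [Matrix.cons_val_zero, Matrix.cons_val_one]
  rcases hx with hx | ⟨i, hi, rfl⟩
  · rw [mem_halfBox_iff] at hx; omega
  · have := cor_coord_bounds (N := N) hM hi; omega

/-- The half-box lies in the box `[-N, N] × [0, N]`. [folklore] -/
theorem halfBox_subset_boxSites : halfBox N ⊆ boxSites ![-(N : ℤ), 0] ![(N : ℤ), N] := by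
  intro x hx
  rw [mem_boxSites_iff, Fin.forall_fin_two]
  simp only [Matrix.cons_val_zero, Matrix.cons_val_one]
  rw [mem_halfBox_iff] at hx; omega

/-! ### Adjacency from coordinates -/

/-- Lattice adjacency from a coordinate description of the step. [folklore] -/
theorem adj_of_coord_cases {x y : Site 2}
    (h : (y 0 = x 0 + 1 ∧ y 1 = x 1) ∨ (y 0 = x 0 - 1 ∧ y 1 = x 1) ∨
      (y 0 = x 0 ∧ y 1 = x 1 + 1) ∨ (y 0 = x 0 ∧ y 1 = x 1 - 1)) : (zdGraph 2).Adj x y := by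
  rcases h with ⟨h0, h1⟩ | ⟨h0, h1⟩ | ⟨h0, h1⟩ | ⟨h0, h1⟩
  · exact Literature.Probability.Percolation.adj_of_stepKind (.right h0 h1)
  · exact Literature.Probability.Percolation.adj_of_stepKind (.left (by omega) h1)
  · exact Literature.Probability.Percolation.adj_of_stepKind (.up h1 h0)
  · exact Literature.Probability.Percolation.adj_of_stepKind (.down (by omega) h0)

/-- Consecutive corridor sites are lattice neighbours. [folklore] -/
theorem adj_cor_succ (hM : 2 ≤ M) {j : ℕ} (hj : j < 2 * M + N) :
    (zdGraph 2).Adj (cor N M j) (cor N M (j + 1)) := by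
  apply adj_of_coord_cases
  have h1 := cor_spec N M j
  have h2 := cor_spec N M (j + 1)
  push_cast at h2
  omega

/-! ### Privacy of the corridor -/

/-- **The corridor is private**: for an internal corridor index `1 ≤ i < m`, every lattice
neighbour of `cor N M i` lying in the gadget is `cor N M (i-1)` or `cor N M (i+1)`. [folklore] -/
theorem corridor_private (hN : 2 ≤ N) (hM : 2 ≤ M) {i : ℕ} (hi1 : 1 ≤ i) (him : i < 2 * M + N)
    {z : Site 2} (hz : z ∈ gadget N M) (hadj : (zdGraph 2).Adj (cor N M i) z) :
    z = cor N M (i - 1) ∨ z = cor N M (i + 1) := by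
  have had := WeakBeurling.coord_step_of_adj hadj
  have hci := cor_spec N M i
  rcases hz with hz | ⟨j, hj, rfl⟩
  · -- a half-box neighbour: only the gateway `g_R`, seen from `g_L = cor N M (m-1)`
    right
    rw [mem_halfBox_iff] at hz
    have key : i + 1 = 2 * M + N ∧ z 0 = -(N : ℤ) ∧ z 1 = 0 := by
      rcases had with had | had | had | had <;> omega
    obtain ⟨hi, hz0, hz1⟩ := key
    rw [hi, cor_m, vec2_eq_iff]
    exact ⟨hz0, hz1⟩
  · -- a corridor neighbour: consecutive index
    have hcj := cor_spec N M j
    have key : j + 1 = i ∨ j = i + 1 := by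
      rcases had with had | had | had | had <;> omega
    rcases key with rfl | rfl
    · left; rw [Nat.add_sub_cancel]
    · right; rfl

/-- **The neighbours of `t = (-1,-1)` in the gadget are `b'` and `cor N M 1`.** [folklore] -/
theorem neighbours_t (hN : 2 ≤ N) (hM : 2 ≤ M) {z : Site 2} (hz : z ∈ gadget N M)
    (hadj : (zdGraph 2).Adj ![-1, -1] z) : z = ![-1, 0] ∨ z = cor N M 1 := by
  rw [cor_one hM, vec2_eq_iff, vec2_eq_iff]
  have had := WeakBeurling.coord_step_of_adj hadj
  simp only [Matrix.cons_val_zero, Matrix.cons_val_one] at had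
  rcases hz with hz | ⟨j, hj, rfl⟩
  · rw [mem_halfBox_iff] at hz; omega
  · have hcj := cor_spec N M j; omega

/-- **The neighbours of `b = (0,0)` in the gadget are `b' = (-1,0)` and `c = (1,0)`** (the notch
`(0,1)` and `(0,-1)` are missing): `deg_V(b) = 2`, which makes interlacing automatic. [folklore] -/
theorem neighbours_b (hM : 2 ≤ M) {z : Site 2} (hz : z ∈ gadget N M)
    (hadj : (zdGraph 2).Adj ![0, 0] z) : z = ![-1, 0] ∨ z = ![1, 0] := by
  rw [vec2_eq_iff, vec2_eq_iff]
  have had := WeakBeurling.coord_step_of_adj hadj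
  simp only [Matrix.cons_val_zero, Matrix.cons_val_one] at had
  rcases hz with hz | ⟨j, hj, rfl⟩
  · rw [mem_halfBox_iff] at hz; omega
  · have := cor_coord_bounds (N := N) hM hj; omega

/-- The same in the half-box alone. [folklore] -/
theorem neighbours_b_halfBox {z : Site 2} (hz : z ∈ halfBox N)
    (hadj : (zdGraph 2).Adj ![0, 0] z) : z = ![-1, 0] ∨ z = ![1, 0] := by
  rw [vec2_eq_iff, vec2_eq_iff]
  have had := WeakBeurling.coord_step_of_adj hadj
  simp only [Matrix.cons_val_zero, Matrix.cons_val_one] at had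
  rw [mem_halfBox_iff] at hz; omega

/-! ### Lattice connectivity -/

/-- A vertical lattice walk inside `T`. [folklore] -/
theorem rtg_col {T : Set (Site 2)} (x0 y1 : ℤ) (n : ℕ)
    (h : ∀ k : ℕ, k ≤ n → (![x0, y1 + k] : Site 2) ∈ T) :
    ReflTransGen (SiteStep T) ![x0, y1] ![x0, y1 + n] := by
  induction n with
  | zero => simp only [Nat.cast_zero, add_zero]; exact ReflTransGen.refl
  | succ n ih =>
    refine (ih fun k hk => h k (by omega)).tail ⟨?_, h n (by omega), by exact_mod_cast h (n + 1) le_rfl⟩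
    exact adj_of_coord_cases (Or.inr (Or.inr (Or.inl ⟨by simp, by
      simp only [Matrix.cons_val_one, Matrix.cons_val_zero, Nat.cast_succ]; ring⟩)))

/-- A horizontal lattice walk inside `T`. [folklore] -/
theorem rtg_row {T : Set (Site 2)} (x1 y0 : ℤ) (n : ℕ)
    (h : ∀ k : ℕ, k ≤ n → (![x1 + k, y0] : Site 2) ∈ T) :
    ReflTransGen (SiteStep T) ![x1, y0] ![x1 + n, y0] := by
  induction n with
  | zero => simp only [Nat.cast_zero, add_zero]; exact ReflTransGen.refl
  | succ n ih =>
    refine (ih fun k hk => h k (by omega)).tail ⟨?_, h n (by omega), by exact_mod_cast h (n + 1) le_rfl⟩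
    exact adj_of_coord_cases (Or.inl ⟨by
      simp only [Matrix.cons_val_zero, Nat.cast_succ]; ring, by simp⟩)

/-- Lattice walks are monotone in the ambient set. [folklore] -/
theorem rtg_mono {T T' : Set (Site 2)} (hT : T ⊆ T') {x y : Site 2}
    (h : ReflTransGen (SiteStep T) x y) : ReflTransGen (SiteStep T') x y := by
  induction h with
  | refl => exact ReflTransGen.refl
  | tail _ hs ih => exact ih.tail ⟨hs.1, hT hs.2.1, hT hs.2.2⟩

/-- Inside `Λ_N \ {b', b}`: every site other than `b', b` is joined to the gateway `g_R = (-N,0)`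
(up its column to the top row, along the top row, down the left column). [folklore] -/
theorem rtg_halfBox_to_gR (hN : 2 ≤ N) {x : Site 2} (hx : x ∈ halfBox N)
    (hxb' : x ≠ ![-1, 0]) (hxb : x ≠ ![0, 0]) :
    ReflTransGen (SiteStep (halfBox N \ {![-1, 0], ![0, 0]})) x ![-(N : ℤ), 0] := by
  set T : Set (Site 2) := halfBox N \ {![-1, 0], ![0, 0]} with hT
  have memT : ∀ p q : ℤ, (![p, q] : Site 2) ∈ T ↔
      (-(N : ℤ) ≤ p ∧ p ≤ N ∧ 0 ≤ q ∧ q ≤ N ∧ ¬ (p = 0 ∧ q = 1)) ∧ ¬ (p = -1 ∧ q = 0) ∧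
        ¬ (p = 0 ∧ q = 0) := by
    intro p q
    rw [hT, mem_sdiff, mem_halfBox_iff, mem_insert_iff, mem_singleton_iff, vec2_eq_iff, vec2_eq_iff]
    simp only [Matrix.cons_val_zero, Matrix.cons_val_one]
    tauto
  rw [mem_halfBox_iff] at hx
  rw [Ne, vec2_eq_iff] at hxb' hxb
  have hxe : x = ![x 0, x 1] := by rw [vec2_eq_iff]; exact ⟨rfl, rfl⟩
  -- up the column `x 0` from `x 1` to `N`
  obtain ⟨n1, hn1⟩ : ∃ n : ℕ, (N : ℤ) = x 1 + n := ⟨((N : ℤ) - x 1).toNat, by omega⟩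
  have s1 : ReflTransGen (SiteStep T) ![x 0, x 1] ![x 0, x 1 + n1] :=
    rtg_col (x 0) (x 1) n1 fun k hk => (memT _ _).2 (by omega)
  -- along the top row from `x 0` to `-N` (leftwards: reverse a rightward walk)
  obtain ⟨n2, hn2⟩ : ∃ n : ℕ, x 0 = -(N : ℤ) + n := ⟨(x 0 + N).toNat, by omega⟩
  have s2 : ReflTransGen (SiteStep T) ![-(N : ℤ), (N : ℤ)] ![-(N : ℤ) + n2, (N : ℤ)] :=
    rtg_row (-(N : ℤ)) N n2 fun k hk => (memT _ _).2 (by omega)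
  -- down the left column from `N` to `0` (reverse an upward walk)
  have s3 : ReflTransGen (SiteStep T) ![-(N : ℤ), 0] ![-(N : ℤ), 0 + (N : ℕ)] :=
    rtg_col (-(N : ℤ)) 0 N fun k hk => (memT _ _).2 (by omega)
  rw [hxe]
  refine (s1.trans ?_).trans (reflTransGen_siteStep_reverse (by simpa using s3))
  have e1 : (![x 0, x 1 + n1] : Site 2) = ![-(N : ℤ) + n2, (N : ℤ)] := by
    rw [vec2_eq_iff]; simp; omega
  rw [e1]
  exact reflTransGen_siteStep_reverse s2

/-- **`Λ_N` is lattice-connected.** [folklore] -/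
theorem halfBox_connected (hN : 2 ≤ N) :
    ∀ x ∈ halfBox N, ∀ y ∈ halfBox N, ReflTransGen (SiteStep (halfBox N)) x y := by
  -- every site reaches `g_R`; `b'` and `b` via `c`/`(-2,0)`… simplest: via their upper… use cases
  have key : ∀ x ∈ halfBox N, ReflTransGen (SiteStep (halfBox N)) x ![-(N : ℤ), 0] := by
    intro x hx
    by_cases hxb' : x = ![-1, 0]
    · -- `b' → (-1,1) → … ` : `(-1,1) ∈ Λ` and is neither `b'` nor `b`
      subst hxb'
      have h1 : (![-1, 1] : Site 2) ∈ halfBox N := by rw [mem_halfBox_iff]; simp; omega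
      refine ReflTransGen.head ⟨adj_of_coord_cases (Or.inr (Or.inr (Or.inl ⟨by simp, by simp⟩))), hx, h1⟩ ?_
      exact rtg_mono sdiff_subset (rtg_halfBox_to_gR hN h1 (by simp) (by simp))
    by_cases hxb : x = ![0, 0]
    · subst hxb
      have h1 : (![1, 0] : Site 2) ∈ halfBox N := c_mem_halfBox hN
      refine ReflTransGen.head ⟨adj_of_coord_cases (Or.inl ⟨by simp, by simp⟩), hx, h1⟩ ?_
      exact rtg_mono sdiff_subset (rtg_halfBox_to_gR hN h1 (by simp) (by simp))
    exact rtg_mono sdiff_subset (rtg_halfBox_to_gR hN hx hxb' hxb)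
  intro x hx y hy
  exact (key x hx).trans (reflTransGen_siteStep_reverse (key y hy))

/-- Along the corridor: `cor N M j ⇝ g_R` inside any `T` containing the corridor sites of index
`≥ j` and `g_R`. [folklore] -/
theorem rtg_cor_to_gR (hM : 2 ≤ M) {T : Set (Site 2)}
    (hT : ∀ i, i ≤ 2 * M + N → cor N M i ∈ T) {j : ℕ} (hj : j ≤ 2 * M + N) :
    ReflTransGen (SiteStep T) (cor N M j) (cor N M (2 * M + N)) := by
  obtain ⟨n, hn⟩ := Nat.exists_eq_add_of_le hj
  clear hj
  induction n generalizing j with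
  | zero => rw [hn, add_zero]
  | succ n ih =>
    have hj : j < 2 * M + N := by omega
    exact ReflTransGen.head ⟨adj_cor_succ hM hj, hT j hj.le, hT (j + 1) (by omega)⟩
      (ih (by omega))

/-- **The gadget is lattice-connected.** [folklore] -/
theorem gadget_connected (hN : 2 ≤ N) (hM : 2 ≤ M) :
    ∀ x ∈ gadget N M, ∀ y ∈ gadget N M, ReflTransGen (SiteStep (gadget N M)) x y := by
  have key : ∀ x ∈ gadget N M, ReflTransGen (SiteStep (gadget N M)) x ![-(N : ℤ), 0] := by
    intro x hx
    rcases hx with hx | ⟨j, hj, rfl⟩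
    · exact rtg_mono subset_union_left (halfBox_connected hN x hx _ (gR_mem_halfBox hN))
    · rw [← cor_m (N := N) (M := M)]
      refine rtg_cor_to_gR hM (fun i hi => ?_) hj.le
      rcases Nat.lt_or_ge i (2 * M + N) with h | h
      · exact Or.inr ⟨i, h, rfl⟩
      · have : i = 2 * M + N := le_antisymm hi h
        rw [this, cor_m]; exact Or.inl (gR_mem_halfBox hN)
  intro x hx y hy
  exact (key x hx).trans (reflTransGen_siteStep_reverse (key y hy))

/-- **`t ⇝ c` inside `V \ {b', b}`**: through the corridor to `g_R`, then inside the half-box.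
[folklore] -/
theorem rtg_t_to_c (hN : 2 ≤ N) (hM : 2 ≤ M) :
    ReflTransGen (SiteStep (gadget N M \ {![-1, 0], ![0, 0]})) ![-1, -1] ![1, 0] := by
  set T : Set (Site 2) := gadget N M \ {![-1, 0], ![0, 0]} with hT
  have hcorT : ∀ i, i ≤ 2 * M + N → cor N M i ∈ T := by
    intro i hi
    refine ⟨?_, ?_⟩
    · rcases Nat.lt_or_ge i (2 * M + N) with h | h
      · exact Or.inr ⟨i, h, rfl⟩
      · rw [le_antisymm hi h, cor_m]; exact Or.inl (gR_mem_halfBox hN)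
    · rw [mem_insert_iff, mem_singleton_iff, not_or]
      exact ⟨cor_ne_b' hN i, cor_ne_b hN i⟩
  have s1 : ReflTransGen (SiteStep T) ![-1, -1] ![-(N : ℤ), 0] := by
    rw [← cor_zero (N := N) hM, ← cor_m (N := N) (M := M)]
    exact rtg_cor_to_gR hM hcorT (Nat.zero_le _)
  have s2 : ReflTransGen (SiteStep T) ![1, 0] ![-(N : ℤ), 0] :=
    rtg_mono (sdiff_subset_sdiff_left subset_union_left)
      (rtg_halfBox_to_gR hN (c_mem_halfBox hN) (by simp) (by simp))
  exact s1.trans (reflTransGen_siteStep_reverse s2)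

end Summit.CriticalPhenomena.SAWScalingLimit.Theorems.BoundaryHarnack.Negative
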